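import Mathlib.Analysis.SpecialFunctions.Log.NegMulLog
import Mathlib.Analysis.SpecialFunctions.Log.Base
import Mathlib.Analysis.Convex.Jensen
import Mathlib.Algebra.BigOperators.Ring.Finset
import Mathlib.Algebra.BigOperators.Fin
import Mathlib.Algebra.Order.BigOperators.Group.Finset
import Mathlib.Data.Fintype.BigOperators
import Mathlib.Data.Int.Interval
import Mathlib.Tactic.FinCases
import Mathlib.Tactic.Positivity
import Mathlib.Tactic.FieldSimp
import Mathlib.Tactic.Ring
import Literature.Dynamics.FractalDistributions.OctreeCPChain
import HarnessLib

/-!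
# Octant-splitting entropy and its chain rule along the mass-driven octree chain

Topic `Literature/Dynamics/FractalDistributions`; definition request `defn-OctantSplittingEntropy`
(route `CriticalPhenomena/Ising3DConformalLimit/OctantEntropy`, crux `QuenchedMassExponent`: "the mean
octant-splitting entropy per level converges").

## Content

* `splittingEntropy s w` — the Shannon entropy **in bits** of the normalised weights
  `(w x / ∑_{y ∈ s} w y)_{x ∈ s}` of a finite family of (nonnegative) weights, `0 log 0 = 0`, junk value
  `0` when the total weight vanishes. This is Furstenberg's entropy function
  `𝓔(Θ) = -∑_{a ∈ Λ} Θ(a) log Θ(a)` of a probability tree at its root (Furstenberg 2014, Ch. 11,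
  p. 42; natural logarithm there, base `2` here), applied to the tree of mass ratios of a measure.
  API: scale invariance (`splittingEntropy_mul_left`), `0 ≤ H ≤ log₂ #s`
  (`splittingEntropy_nonneg`, `splittingEntropy_le_logb_card`), the value `log₂ #(s ∩ S)` on counting
  weights (`splittingEntropy_indicator`), and the **chain rule / grouping identity**
  `H(s, w) = H(coarse) + ∑_j (W_j / W) H(fibre_j, w)` for the fibres of any map `g : α → β`
  (`splittingEntropy_fiberwise`; Leinster 2021, Prop. 2.2.8 `H(w ∘ (p¹,…,pⁿ)) = H(w) + ∑ wᵢ H(pⁱ)`,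
  proved there — as here — from `∂(xy) = ∂(x) y + x ∂(y)` for `∂ = negMulLog`, Mathlib's
  `Real.negMulLog_mul`; Cover–Thomas 2006, Thm. 2.5.1 is the random-variable form).
* Discrete dyadic cubes of `ℤ^d`: `dyadicCube n a = ∏ᵢ [a i, a i + 2^n)` (side `2^n`, "level `n`"),
  their `2^d` children `dyadicCube (n-1) (childCorner (n-1) a e)` labelled by the octant indices
  `e : Octant d = Fin d → Fin 2` of `OctreeCPChain.lean` (octants for `d = 3`), the label `octantOf` of
  the child containing a site, and the partition lemma `sum_dyadicCube_succ`.
* For site weights `m : (Fin d → ℤ) → ℝ` (a finite measure `μ` on the cube; the route's case is the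
  counting measure of a cluster): `octantMass m n a e = μ(Q_e)`, the masses of the `2^d` children `Q_e` of
  `Q = dyadicCube (n+1) a`; `octantEntropy m n a = H_{2^d}(μ, Q) = -∑_e (μ(Q_e)/μ(Q)) log₂ (μ(Q_e)/μ(Q))`
  `∈ [0, d]`; and `meanLevelEntropy m n a k = h_k`, the mean splitting entropy at depth `k` below
  `Q₀ = dyadicCube n a` along the **mass-driven `2^d`-ary chain** `Q₀ ⊃ Q₁ ⊃ ⋯` that steps from a cube to
  its child `Q_e` with probability `μ(Q_e)/μ(Q)` (Furstenberg's Markov process on probability trees,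
  Furstenberg 2014 Ch. 5, Ch. 11; Furstenberg 2008 §1; Hochman 2010 §1.4: CP-chains), defined by the
  first-step recursion `h_0(Q) = H_{2^d}(μ, Q)`, `h_{k+1}(Q) = ∑_e (μ(Q_e)/μ(Q)) h_k(Q_e)`, i.e.
  `h_k(Q₀) = E_chain[H_{2^d}(μ, Q_k)] = (𝒯ᵏ𝓔)(Θ_μ)` in Furstenberg's notation
  (`𝒯ᵏF(Θ) = ∑_{|w| = k} Θ(w) F(Θ^w)`, Ch. 11, p. 42).
* The **exact chain-rule identity** (`sum_range_meanLevelEntropy`): for `0 ≤ m` and a cube `Q₀` of level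
  `n` (side `2^n`, split `n` times down to sites),
  `∑_{k < n} h_k = H(μ|_{Q₀} / μ(Q₀))`, the Shannon entropy in bits of the normalised atomic measure on the
  sites of `Q₀` — Furstenberg 2014, Ch. 11, p. 42:
  `(1/L) ∑_{j<L} 𝒯ʲ𝓔(Θ) = -(1/L) ∑_{|w| = L} Θ(w) log Θ(w)` (multiplied through by `L`); and its
  counting-measure case (`sum_range_meanLevelEntropy_indicator`): for a finite `S ⊆ Q₀`,
  `∑_{k < n} h_k(𝟙_S) = log₂ #S` (ibid. Ch. 12, p. 46: `= log N_l(τ_l) / l` for the uniform tree), which is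
  the dictionary `E[log₂ mass_K] = ∑_{k=0}^{K} E[h_k]` used by the route (window `[-2^K, 2^K)^3 =
  dyadicCube (K+1) (fun _ => -2^K)`, `mem_dyadicCube_window`).
* The same two quantities on the states of the CP-chain of `OctreeCPChain.lean` (probability measures
  `θ` on `[0,1)^d`, kernel `θ ↦ ∑_ε θ(C_ε) δ_{θ^{C_ε}}`): `cpEntropy θ = -∑_ε θ(C_ε) log₂ θ(C_ε)`
  (Furstenberg's `𝓔` at the state `θ`, the functional whose mean against an ergodic CP-distribution is
  the dimension, Furstenberg 2008 Thm. 2.1 — that theorem is NOT stated here) and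
  `cpLevelEntropy θ k = ∑_{|w|=k} θ(D_w) 𝓔(θ^{D_w}) = E_{lawAt θ k}[𝓔]` written out on words exactly as
  `lawAt` is, with `cpLevelEntropy_succ` (first-step recursion, the same recursion as
  `meanLevelEntropy_succ`), `0 ≤ · ≤ d`, and `sum_toReal_cellMass` (`∑_{|w|=k} θ(D_w) = 1`).

## Design choices

* Entropy over a `Finset` of an arbitrary type with real weights (rather than `Fin 8 → ℝ`): one notion
  serves both the `2^d` children of a cube (`s = univ : Finset (Octant d)`) and the sites of a cube
  (`s = dyadicCube n a`), which is what makes the chain rule a statement about a single function.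
  Normalisation is internal (`w x / ∑ w`), so `H` is invariant under scaling the measure
  (`splittingEntropy_mul_left`): the CP-chain's "normalised blown-up measure" and the raw restricted
  measure have the same splitting entropies. Lean's `x / 0 = 0` realises the junk value `H = 0` for a
  null cube with no case split. Bits (`/ Real.log 2`) as in the route (`log₂ mass`), so that
  `0 ≤ H_{2^d} ≤ d` (`octantEntropy_le`: three bits for octants).
* `Literature.Computability.AlgebraicComplexity.shannonEntropy P = (∑ negMulLog (P x)) / log 2`
  (CVZ quantum functionals) is the same quantity on an already-normalised `P` over a `Fintype`; it is not
  imported here (that module pulls in matrix spectra); `splittingEntropy univ w` equals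
  `shannonEntropy (fun x => w x / ∑ y, w y)` by `rfl` up to unfolding.
* General dimension `d` and dyadic (`b = 2`) splitting: the route needs `d = 3`; `d` is free. General
  `b`-adic splitting (Furstenberg's `Λ = {0,…,b-1}^d`) would replace `Fin 2` by `Fin b` and `2 ^ n` by
  `b ^ n` throughout; not done (no requester).
* NOT here: the CP-chain itself (kernel, CP-distributions, `lawAt`, `latticeState`: all in
  `OctreeCPChain.lean`, imported), the dimension formula `dim = ∫ 𝓔 dP / log b` for ergodic
  CP-distributions (Furstenberg 2008 Thm. 2.1; Hochman 2010 Prop. 1.19), and the identification of the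
  CP-chain started at `latticeState d K A` with the discrete chain of the counting measure of `A`
  (`cpLevelEntropy (latticeState d K A _ _) k = meanLevelEntropy 𝟙_A (K+1) (-2^K) k`, a computation with
  finite sums of Dirac masses) — only the finite, exact bookkeeping lives in this file.

## References

* H. Furstenberg, *Ergodic Theory and Fractal Geometry*, CBMS 120, AMS (2014), Ch. 5 (p. 23), Ch. 11
  (p. 42), Ch. 12 (p. 46). [Furstenberg2014]
* H. Furstenberg, Ergodic fractal measures and dimension conservation, ETDS 28 (2008) 405–422, §1.
  [Furstenberg2008]
* M. Hochman, Dynamics on fractals and fractal distributions, arXiv:1008.3731, §1.4.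
  [Hochman2010FractalDistributions]
* T. Leinster, *Entropy and Diversity*, CUP (2021), Prop. 2.2.8 (chain rule). [Leinster2021]
* T. M. Cover, J. A. Thomas, *Elements of Information Theory*, 2nd ed. (2006), Thm. 2.5.1. [CoverThomas2006]
-/

noncomputable section

open scoped BigOperators
open Finset Real

namespace Literature.Dynamics.FractalDistributions

/-! ## Splitting entropy of a finite family of weights -/

section SplittingEntropy

variable {α : Type*}

/-- The **splitting entropy** (Shannon entropy in bits of the normalised weights) of the weights `w` on
the finite set `s`: `H(s, w) = -∑_{x ∈ s} pₓ log₂ pₓ` with `pₓ = w x / ∑_{y ∈ s} w y` and `0 log 0 = 0`;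
if the total weight is `0` every `pₓ = 0` and `H = 0` (junk value). Furstenberg's entropy function
`𝓔(Θ) = -∑_a Θ(a) log Θ(a)` of the probability tree of mass ratios, in base `2`.
[cite: Furstenberg2014, Ch. 11, p. 42] -/
def splittingEntropy (s : Finset α) (w : α → ℝ) : ℝ :=
  (∑ x ∈ s, negMulLog (w x / ∑ y ∈ s, w y)) / Real.log 2

/-- Unfolding of `splittingEntropy`. [folklore] -/
theorem splittingEntropy_def (s : Finset α) (w : α → ℝ) :
    splittingEntropy s w = (∑ x ∈ s, negMulLog (w x / ∑ y ∈ s, w y)) / Real.log 2 := rfl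

/-- The splitting entropy only depends on the normalised weights: scaling all weights by `c ≠ 0`
does not change it. [folklore] -/
theorem splittingEntropy_mul_left (s : Finset α) (w : α → ℝ) {c : ℝ} (hc : c ≠ 0) :
    splittingEntropy s (fun x => c * w x) = splittingEntropy s w := by
  simp only [splittingEntropy, ← mul_sum, mul_div_mul_left _ _ hc]

/-- The splitting entropy of the empty family is `0`. [folklore] -/
@[simp] theorem splittingEntropy_empty (w : α → ℝ) : splittingEntropy ∅ w = 0 := by
  simp [splittingEntropy]

/-- A single cell carries no splitting entropy. [folklore] -/
@[simp] theorem splittingEntropy_singleton (a : α) (w : α → ℝ) : splittingEntropy {a} w = 0 := by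
  simp only [splittingEntropy, sum_singleton]
  by_cases h : w a = 0
  · simp [h]
  · simp [div_self h]

/-- `-∑ pₓ log pₓ ≥ 0` for nonnegative weights (each `pₓ ∈ [0, 1]`). [folklore] -/
theorem sum_negMulLog_div_nonneg (s : Finset α) (w : α → ℝ) (hw : ∀ x ∈ s, 0 ≤ w x) :
    0 ≤ ∑ x ∈ s, negMulLog (w x / ∑ y ∈ s, w y) := by
  refine sum_nonneg fun x hx => negMulLog_nonneg (div_nonneg (hw x hx) (sum_nonneg hw)) ?_
  exact div_le_one_of_le₀ (single_le_sum hw hx) (sum_nonneg hw)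

/-- `0 ≤ H(s, w)` for nonnegative weights. [folklore] -/
theorem splittingEntropy_nonneg (s : Finset α) (w : α → ℝ) (hw : ∀ x ∈ s, 0 ≤ w x) :
    0 ≤ splittingEntropy s w :=
  div_nonneg (sum_negMulLog_div_nonneg s w hw) (Real.log_nonneg one_le_two)

/-- `-∑ pₓ log pₓ ≤ log #s` for nonnegative weights (Jensen's inequality for the concave
`x ↦ -x log x`). [folklore] -/
theorem sum_negMulLog_div_le_log_card (s : Finset α) (w : α → ℝ) (hw : ∀ x ∈ s, 0 ≤ w x) :
    ∑ x ∈ s, negMulLog (w x / ∑ y ∈ s, w y) ≤ Real.log #s := by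
  by_cases hW0 : ∑ y ∈ s, w y = 0
  · simp only [hW0, div_zero, negMulLog_zero, sum_const_zero]
    exact Real.log_natCast_nonneg _
  have hs : s.Nonempty := by
    by_contra h
    rw [not_nonempty_iff_eq_empty] at h
    exact hW0 (by simp [h])
  have hN : (0 : ℝ) < #s := by exact_mod_cast hs.card_pos
  have hJ := Real.concaveOn_negMulLog.le_map_sum (t := s) (w := fun _ => (#s : ℝ)⁻¹)
    (p := fun x => w x / ∑ y ∈ s, w y) (fun _ _ => by positivity) (by simp [hN.ne'])
    (fun i hi => Set.mem_Ici.2 (div_nonneg (hw i hi) (sum_nonneg hw)))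
  simp only [smul_eq_mul, ← mul_sum, ← sum_div, div_self hW0, mul_one] at hJ
  rw [Real.negMulLog, Real.log_inv, mul_neg, neg_mul, neg_neg] at hJ
  exact le_of_mul_le_mul_left hJ (inv_pos.2 hN)

/-- `H(s, w) ≤ log₂ #s` for nonnegative weights. [folklore] -/
theorem splittingEntropy_le_logb_card (s : Finset α) (w : α → ℝ) (hw : ∀ x ∈ s, 0 ≤ w x) :
    splittingEntropy s w ≤ Real.logb 2 #s := by
  rw [splittingEntropy, ← Real.log_div_log]
  exact div_le_div_of_nonneg_right (sum_negMulLog_div_le_log_card s w hw) (Real.log_nonneg one_le_two)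

/-- Counting weights: the splitting entropy of the indicator of `S` on `s` is `log₂ #(s ∩ S)` (the
uniform distribution on `N` cells has entropy `log₂ N`; `N = 0` gives the junk value `0 = log₂ 0`).
[cite: Furstenberg2014, Ch. 12, p. 46] -/
theorem splittingEntropy_indicator [DecidableEq α] (s S : Finset α) :
    splittingEntropy s (fun x => if x ∈ S then 1 else 0) = Real.logb 2 #(s ∩ S) := by
  unfold splittingEntropy
  have hsum : ∑ y ∈ s, (if y ∈ S then (1 : ℝ) else 0) = #(s ∩ S) := by
    rw [sum_boole, filter_mem_eq_inter]
  rw [hsum]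
  have hx : ∀ x ∈ s, negMulLog ((if x ∈ S then (1 : ℝ) else 0) / #(s ∩ S)) =
      if x ∈ S then negMulLog (1 / #(s ∩ S)) else 0 := by
    intro x _
    split_ifs <;> simp
  rw [sum_congr rfl hx, ← sum_filter, filter_mem_eq_inter, sum_const, nsmul_eq_mul, ← Real.log_div_log,
    one_div, Real.negMulLog, Real.log_inv]
  by_cases hN : (#(s ∩ S) : ℝ) = 0
  · simp [hN]
  · rw [neg_mul_neg, ← mul_assoc, mul_inv_cancel₀ hN, one_mul]

/-- The splitting entropy only depends on the weights on `s`. [folklore] -/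
theorem splittingEntropy_congr {s : Finset α} {w w' : α → ℝ} (h : ∀ x ∈ s, w x = w' x) :
    splittingEntropy s w = splittingEntropy s w' := by
  have hs : ∑ y ∈ s, w y = ∑ y ∈ s, w' y := sum_congr rfl h
  simp only [splittingEntropy, hs]
  congr 1
  exact sum_congr rfl fun x hx => by rw [h x hx]

/-- Uniform nonzero weights on `s` have splitting entropy `log₂ #s`. [folklore] -/
theorem splittingEntropy_const [DecidableEq α] (s : Finset α) {c : ℝ} (hc : c ≠ 0) :
    splittingEntropy s (fun _ => c) = Real.logb 2 #s := by
  have h := splittingEntropy_indicator s s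
  rw [inter_self] at h
  rw [← h, ← splittingEntropy_mul_left s (fun x => if x ∈ s then (1 : ℝ) else 0) hc]
  exact splittingEntropy_congr fun x hx => by rw [if_pos hx, mul_one]

/-- **Grouping identity for `-∑ p log p`** along the fibres of a map `g : α → β` (nonnegative weights):
`∑_{x ∈ s} ∂(wₓ/W) = ∑_j ∂(W_j/W) + ∑_j (W_j/W) ∑_{x ∈ fibre j} ∂(wₓ/W_j)` with `∂ = negMulLog`,
`W = ∑_s w`, `W_j` the weight of the fibre `{x ∈ s | g x = j}`; from `∂(xy) = ∂(x) y + x ∂(y)`.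
[cite: Leinster2021, Prop. 2.2.8] -/
theorem sum_negMulLog_div_fiberwise {β : Type*} [DecidableEq β] (s : Finset α) (t : Finset β)
    (g : α → β) (hg : ∀ x ∈ s, g x ∈ t) (w : α → ℝ) (hw : ∀ x ∈ s, 0 ≤ w x) :
    ∑ x ∈ s, negMulLog (w x / ∑ y ∈ s, w y) =
      ∑ j ∈ t, negMulLog ((∑ x ∈ s with g x = j, w x) / ∑ y ∈ s, w y) +
      ∑ j ∈ t, (∑ x ∈ s with g x = j, w x) / (∑ y ∈ s, w y) *
        ∑ x ∈ s with g x = j, negMulLog (w x / ∑ y ∈ s with g y = j, w y) := by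
  set W := ∑ y ∈ s, w y with hW
  rw [← sum_fiberwise_of_maps_to hg (fun x => negMulLog (w x / W)), ← sum_add_distrib]
  refine sum_congr rfl fun j _ => ?_
  set Wj := ∑ x ∈ s with g x = j, w x with hWj
  by_cases hWj0 : Wj = 0
  · have h0 : ∀ x ∈ s.filter (fun x => g x = j), w x = 0 :=
      (sum_eq_zero_iff_of_nonneg fun y hy => hw y (mem_of_mem_filter y hy)).1 hWj0
    rw [hWj0, zero_div, negMulLog_zero, zero_mul, add_zero]
    exact sum_eq_zero fun x hx => by rw [h0 x hx, zero_div, negMulLog_zero]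
  · have hsplit : ∀ x, w x / W = Wj / W * (w x / Wj) := fun x => by
      rw [div_mul_div_comm, mul_comm W Wj, mul_div_mul_left _ _ hWj0]
    calc ∑ x ∈ s with g x = j, negMulLog (w x / W)
        = ∑ x ∈ s with g x = j, (w x / Wj * negMulLog (Wj / W) + Wj / W * negMulLog (w x / Wj)) :=
          sum_congr rfl fun x _ => by rw [hsplit x, negMulLog_mul]
      _ = (∑ x ∈ s with g x = j, w x / Wj) * negMulLog (Wj / W) +
            Wj / W * ∑ x ∈ s with g x = j, negMulLog (w x / Wj) := by
          rw [sum_add_distrib, sum_mul, mul_sum]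
      _ = _ := by rw [← sum_div, ← hWj, div_self hWj0, one_mul]

/-- **Chain rule (grouping) for the splitting entropy**: for nonnegative weights and a map `g : α → β`
with `g(s) ⊆ t`, `H(s, w) = H(t, j ↦ W_j) + ∑_{j ∈ t} (W_j / W) · H({x ∈ s | g x = j}, w)` —
Leinster's `H(w ∘ (p¹, …, pⁿ)) = H(w) + ∑ᵢ wᵢ H(pⁱ)`. [cite: Leinster2021, Prop. 2.2.8] -/
theorem splittingEntropy_fiberwise {β : Type*} [DecidableEq β] (s : Finset α) (t : Finset β)
    (g : α → β) (hg : ∀ x ∈ s, g x ∈ t) (w : α → ℝ) (hw : ∀ x ∈ s, 0 ≤ w x) :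
    splittingEntropy s w =
      splittingEntropy t (fun j => ∑ x ∈ s with g x = j, w x) +
      ∑ j ∈ t, (∑ x ∈ s with g x = j, w x) / (∑ y ∈ s, w y) *
        splittingEntropy (s.filter fun x => g x = j) w := by
  simp only [splittingEntropy]
  rw [sum_fiberwise_of_maps_to hg w, sum_negMulLog_div_fiberwise s t g hg w hw, add_div]
  congr 1
  rw [sum_div]
  exact sum_congr rfl fun j _ => by rw [mul_div_assoc]

end SplittingEntropy

/-! ## Dyadic cubes of `ℤ^d` and their `2^d` children -/

section Cubes

variable {d : ℕ}

-- The labels of the `2^d` children of a cube are the octant indices `Octant d = Fin d → Fin 2` of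
-- `OctreeCPChain.lean` (`e i = 0`: lower half, `e i = 1`: upper half in coordinate `i`).

/-- The discrete **dyadic cube** of level `n` (side `2^n`) with lower corner `a`:
`{x ∈ ℤ^d | ∀ i, a i ≤ x i < a i + 2^n}`. [folklore] -/
def dyadicCube (n : ℕ) (a : Fin d → ℤ) : Finset (Fin d → ℤ) :=
  Fintype.piFinset fun i => Finset.Ico (a i) (a i + 2 ^ n)

/-- Membership in a dyadic cube, coordinatewise. [folklore] -/
theorem mem_dyadicCube {n : ℕ} {a x : Fin d → ℤ} :
    x ∈ dyadicCube n a ↔ ∀ i, a i ≤ x i ∧ x i < a i + 2 ^ n := by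
  simp [dyadicCube, Fintype.mem_piFinset]

/-- The route's dyadic window `[-2^K, 2^K)^d` is the dyadic cube of level `K+1` with corner `-2^K`.
[folklore] -/
theorem mem_dyadicCube_window {K : ℕ} {x : Fin d → ℤ} :
    x ∈ dyadicCube (K + 1) (fun _ => -2 ^ K) ↔ ∀ i, -(2 ^ K : ℤ) ≤ x i ∧ x i < 2 ^ K := by
  rw [mem_dyadicCube]
  have h : -(2 : ℤ) ^ K + 2 ^ (K + 1) = 2 ^ K := by ring
  simp only [h]

/-- A dyadic cube of level `n` has `2^(d n)` sites. [folklore] -/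
theorem card_dyadicCube (n : ℕ) (a : Fin d → ℤ) : #(dyadicCube n a) = 2 ^ (d * n) := by
  have h : ∀ i, #(Finset.Ico (a i) (a i + 2 ^ n)) = 2 ^ n := fun i => by
    rw [Int.card_Ico, add_sub_cancel_left]
    exact_mod_cast Int.toNat_natCast (2 ^ n)
  rw [dyadicCube, Fintype.card_piFinset, prod_congr rfl fun i _ => h i, prod_const, card_univ,
    Fintype.card_fin, ← pow_mul, mul_comm]

/-- The cube of level `0` is the single site `a`. [folklore] -/
theorem dyadicCube_zero (a : Fin d → ℤ) : dyadicCube 0 a = {a} := by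
  ext x
  simp only [mem_dyadicCube, pow_zero, mem_singleton]
  constructor
  · intro h
    funext i
    have := h i
    omega
  · rintro rfl i
    omega

/-- The lower corner `a + 2^n e` of the child labelled `e` of the cube `dyadicCube (n+1) a`; the child
itself is `dyadicCube n (childCorner n a e)`. [folklore] -/
def childCorner (n : ℕ) (a : Fin d → ℤ) (e : Octant d) : Fin d → ℤ :=
  fun i => a i + 2 ^ n * ((e i : ℕ) : ℤ)

/-- The label of the child of `dyadicCube (n+1) a` containing the site `x`: lower or upper half in each
coordinate. [folklore] -/
def octantOf (n : ℕ) (a x : Fin d → ℤ) : Octant d :=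
  fun i => if x i < a i + 2 ^ n then 0 else 1

/-- One coordinate of `filter_octantOf_eq`. [folklore] -/
private theorem coord_aux (lo x N : ℤ) :
    ∀ b : Fin 2, ((lo ≤ x ∧ x < lo + 2 * N) ∧ (if x < lo + N then (0 : Fin 2) else 1) = b) ↔
      (lo + N * ((b : ℕ) : ℤ) ≤ x ∧ x < lo + N * ((b : ℕ) : ℤ) + N) := by
  rw [Fin.forall_fin_two, Fin.val_zero, Fin.val_one, Nat.cast_zero, Nat.cast_one, mul_zero, add_zero,
    mul_one]
  constructor
  · by_cases h : x < lo + N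
    · rw [if_pos h]
      exact ⟨fun H => ⟨H.1.1, h⟩, fun H => ⟨⟨H.1, by omega⟩, rfl⟩⟩
    · rw [if_neg h]
      exact ⟨fun H => absurd H.2 (by decide), fun H => absurd H.2 h⟩
  · by_cases h : x < lo + N
    · rw [if_pos h]
      exact ⟨fun H => absurd H.2 (by decide), fun H => absurd h (not_lt.2 H.1)⟩
    · rw [if_neg h]
      exact ⟨fun H => ⟨not_lt.1 h, by omega⟩, fun H => ⟨⟨by omega, by omega⟩, rfl⟩⟩

/-- The sites of `dyadicCube (n+1) a` with child label `e` are exactly the child cube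
`dyadicCube n (childCorner n a e)`. [folklore] -/
theorem filter_octantOf_eq (n : ℕ) (a : Fin d → ℤ) (e : Octant d) :
    (dyadicCube (n + 1) a).filter (fun x => octantOf n a x = e) = dyadicCube n (childCorner n a e) := by
  ext x
  simp only [mem_filter, mem_dyadicCube, childCorner]
  rw [funext_iff, ← forall_and]
  refine forall_congr' fun i => ?_
  rw [pow_succ']
  exact coord_aux (a i) (x i) (2 ^ n) (e i)

/-- Each child cube lies inside its parent. [folklore] -/
theorem dyadicCube_childCorner_subset (n : ℕ) (a : Fin d → ℤ) (e : Octant d) :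
    dyadicCube n (childCorner n a e) ⊆ dyadicCube (n + 1) a := by
  rw [← filter_octantOf_eq]
  exact filter_subset _ _

/-- **Partition of a cube into its `2^d` children**: a sum over `dyadicCube (n+1) a` is the sum over the
labels `e` of the sums over the children `dyadicCube n (childCorner n a e)`. [folklore] -/
theorem sum_dyadicCube_succ {M : Type*} [AddCommMonoid M] (n : ℕ) (a : Fin d → ℤ)
    (f : (Fin d → ℤ) → M) :
    ∑ x ∈ dyadicCube (n + 1) a, f x = ∑ e : Octant d, ∑ x ∈ dyadicCube n (childCorner n a e), f x := by
  rw [← sum_fiberwise_of_maps_to (s := dyadicCube (n + 1) a) (t := univ) (g := octantOf n a)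
    (fun x _ => mem_univ _) f]
  exact sum_congr rfl fun e _ => by rw [filter_octantOf_eq]

/-- There are `2^d` child labels (eight octants for `d = 3`). [folklore] -/
theorem card_octant (d : ℕ) : Fintype.card (Octant d) = 2 ^ d := by
  rw [Fintype.card_fun, Fintype.card_fin, Fintype.card_fin]

end Cubes

/-! ## Octant masses, octant-splitting entropy, mean level entropies -/

section Octree

variable {d : ℕ}

/-- The masses `μ(Q_e) = ∑_{x ∈ Q_e} m x` of the `2^d` children `Q_e = dyadicCube n (childCorner n a e)`
of the cube `Q = dyadicCube (n+1) a`, for site weights `m` (a finite measure on `ℤ^d`): the first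
level `(Θ(e))_e` of the probability tree of `μ` below `Q`, before normalisation.
[cite: Furstenberg2014, Ch. 5, p. 23] -/
def octantMass (m : (Fin d → ℤ) → ℝ) (n : ℕ) (a : Fin d → ℤ) (e : Octant d) : ℝ :=
  ∑ x ∈ dyadicCube n (childCorner n a e), m x

/-- Unfolding of `octantMass`. [folklore] -/
theorem octantMass_def (m : (Fin d → ℤ) → ℝ) (n : ℕ) (a : Fin d → ℤ) (e : Octant d) :
    octantMass m n a e = ∑ x ∈ dyadicCube n (childCorner n a e), m x := rfl

/-- The child masses add up to the mass of the parent cube. [folklore] -/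
theorem sum_octantMass (m : (Fin d → ℤ) → ℝ) (n : ℕ) (a : Fin d → ℤ) :
    ∑ e, octantMass m n a e = ∑ x ∈ dyadicCube (n + 1) a, m x :=
  (sum_dyadicCube_succ n a m).symm

/-- Child masses of a nonnegative weight are nonnegative. [folklore] -/
theorem octantMass_nonneg {m : (Fin d → ℤ) → ℝ} (hm : ∀ x, 0 ≤ m x) (n : ℕ) (a : Fin d → ℤ)
    (e : Octant d) : 0 ≤ octantMass m n a e :=
  sum_nonneg fun x _ => hm x

/-- The **octant-splitting entropy** (in bits) of the site weights `m` on the cube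
`Q = dyadicCube (n+1) a`: `H_{2^d}(μ, Q) = -∑_e (μ(Q_e)/μ(Q)) log₂ (μ(Q_e)/μ(Q))` over its `2^d`
children (`0 log 0 = 0`; `0` if `μ(Q) = 0`). Furstenberg's `𝓔(Θ)` at the root of the tree of mass
ratios of `μ` below `Q`, in base `2`. [cite: Furstenberg2014, Ch. 11, p. 42] -/
def octantEntropy (m : (Fin d → ℤ) → ℝ) (n : ℕ) (a : Fin d → ℤ) : ℝ :=
  splittingEntropy univ (octantMass m n a)

/-- `octantEntropy` written with the parent mass `μ(Q)` as normaliser. [folklore] -/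
theorem octantEntropy_eq (m : (Fin d → ℤ) → ℝ) (n : ℕ) (a : Fin d → ℤ) :
    octantEntropy m n a =
      (∑ e, negMulLog (octantMass m n a e / ∑ x ∈ dyadicCube (n + 1) a, m x)) / Real.log 2 := by
  rw [octantEntropy, splittingEntropy, sum_octantMass]

/-- `0 ≤ H_{2^d}(μ, Q)` for a nonnegative weight. [folklore] -/
theorem octantEntropy_nonneg {m : (Fin d → ℤ) → ℝ} (hm : ∀ x, 0 ≤ m x) (n : ℕ) (a : Fin d → ℤ) :
    0 ≤ octantEntropy m n a :=
  splittingEntropy_nonneg _ _ fun e _ => octantMass_nonneg hm n a e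

/-- `H_{2^d}(μ, Q) ≤ d` bits (three bits for the eight octants of a cube of `ℤ³`). [folklore] -/
theorem octantEntropy_le {m : (Fin d → ℤ) → ℝ} (hm : ∀ x, 0 ≤ m x) (n : ℕ) (a : Fin d → ℤ) :
    octantEntropy m n a ≤ d := by
  have h := splittingEntropy_le_logb_card univ (octantMass m n a) fun e _ => octantMass_nonneg hm n a e
  rw [card_univ, card_octant, Nat.cast_pow, Nat.cast_ofNat, Real.logb_pow,
    Real.logb_self_eq_one one_lt_two, mul_one] at h
  exact h

/-- The **mean level-`k` splitting entropy** `h_k` below the cube `Q₀ = dyadicCube n a` along the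
mass-driven `2^d`-ary chain `Q₀ ⊃ Q₁ ⊃ ⋯` (from a cube step to its child `Q_e` with probability
`μ(Q_e)/μ(Q)`): `h_k(Q₀) = E[H_{2^d}(μ, Q_k)]`, defined by first-step analysis
`h_0(Q) = H_{2^d}(μ, Q)`, `h_{k+1}(Q) = ∑_e (μ(Q_e)/μ(Q)) h_k(Q_e)`; a cube of level `0` (a single
site) is not split, value `0`. In Furstenberg's notation `h_k = 𝒯ᵏ𝓔 (Θ)` with
`𝒯ᵏF(Θ) = ∑_{|w|=k} Θ(w) F(Θ^w)`, in base `2`. [cite: Furstenberg2014, Ch. 11, p. 42] -/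
def meanLevelEntropy (m : (Fin d → ℤ) → ℝ) : ℕ → (Fin d → ℤ) → ℕ → ℝ
  | 0, _, _ => 0
  | n + 1, a, 0 => octantEntropy m n a
  | n + 1, a, k + 1 =>
      ∑ e, octantMass m n a e / (∑ x ∈ dyadicCube (n + 1) a, m x) *
        meanLevelEntropy m n (childCorner n a e) k

/-- A single site is not split: all its level entropies vanish. [folklore] -/
@[simp] theorem meanLevelEntropy_level_zero (m : (Fin d → ℤ) → ℝ) (a : Fin d → ℤ) (k : ℕ) :
    meanLevelEntropy m 0 a k = 0 := rfl

/-- `h_0(Q) = H_{2^d}(μ, Q)`. [folklore] -/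
@[simp] theorem meanLevelEntropy_zero (m : (Fin d → ℤ) → ℝ) (n : ℕ) (a : Fin d → ℤ) :
    meanLevelEntropy m (n + 1) a 0 = octantEntropy m n a := rfl

/-- First-step (Markov) recursion `h_{k+1}(Q) = ∑_e (μ(Q_e)/μ(Q)) h_k(Q_e)`. [folklore] -/
theorem meanLevelEntropy_succ (m : (Fin d → ℤ) → ℝ) (n : ℕ) (a : Fin d → ℤ) (k : ℕ) :
    meanLevelEntropy m (n + 1) a (k + 1) =
      ∑ e, octantMass m n a e / (∑ x ∈ dyadicCube (n + 1) a, m x) *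
        meanLevelEntropy m n (childCorner n a e) k := rfl

/-- Below depth `n` a cube of level `n` has been split into sites: `h_k = 0` for `k ≥ n`. [folklore] -/
theorem meanLevelEntropy_eq_zero_of_le (m : (Fin d → ℤ) → ℝ) :
    ∀ (n : ℕ) (a : Fin d → ℤ) (k : ℕ), n ≤ k → meanLevelEntropy m n a k = 0
  | 0, _, _, _ => rfl
  | n + 1, a, 0, h => absurd h (by omega)
  | n + 1, a, k + 1, h => by
    rw [meanLevelEntropy_succ]
    exact sum_eq_zero fun e _ => by rw [meanLevelEntropy_eq_zero_of_le m n _ k (by omega), mul_zero]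

/-- The transition weights `μ(Q_e)/μ(Q)` of the mass-driven chain are nonnegative … [folklore] -/
theorem octantMass_div_nonneg {m : (Fin d → ℤ) → ℝ} (hm : ∀ x, 0 ≤ m x) (n : ℕ) (a : Fin d → ℤ)
    (e : Octant d) : 0 ≤ octantMass m n a e / ∑ x ∈ dyadicCube (n + 1) a, m x :=
  div_nonneg (octantMass_nonneg hm n a e) (sum_nonneg fun x _ => hm x)

/-- … and sum to at most `1` (to exactly `1` unless `μ(Q) = 0`). [folklore] -/
theorem sum_octantMass_div_le_one {m : (Fin d → ℤ) → ℝ} (n : ℕ) (a : Fin d → ℤ) :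
    ∑ e, octantMass m n a e / ∑ x ∈ dyadicCube (n + 1) a, m x ≤ 1 := by
  rw [← sum_div, sum_octantMass]
  exact div_self_le_one _

/-- The transition weights sum to `1` when the parent cube has positive mass. [folklore] -/
theorem sum_octantMass_div_eq_one {m : (Fin d → ℤ) → ℝ} (n : ℕ) (a : Fin d → ℤ)
    (h : ∑ x ∈ dyadicCube (n + 1) a, m x ≠ 0) :
    ∑ e, octantMass m n a e / ∑ x ∈ dyadicCube (n + 1) a, m x = 1 := by
  rw [← sum_div, sum_octantMass, div_self h]

/-- `0 ≤ h_k` for a nonnegative weight. [folklore] -/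
theorem meanLevelEntropy_nonneg {m : (Fin d → ℤ) → ℝ} (hm : ∀ x, 0 ≤ m x) :
    ∀ (n : ℕ) (a : Fin d → ℤ) (k : ℕ), 0 ≤ meanLevelEntropy m n a k
  | 0, _, _ => by simp
  | n + 1, a, 0 => octantEntropy_nonneg hm n a
  | n + 1, a, k + 1 => by
    rw [meanLevelEntropy_succ]
    exact sum_nonneg fun e _ =>
      mul_nonneg (octantMass_div_nonneg hm n a e) (meanLevelEntropy_nonneg hm n _ k)

/-- `h_k ≤ d` bits for a nonnegative weight (a convex sub-combination of octant entropies `≤ d`).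
[folklore] -/
theorem meanLevelEntropy_le {m : (Fin d → ℤ) → ℝ} (hm : ∀ x, 0 ≤ m x) :
    ∀ (n : ℕ) (a : Fin d → ℤ) (k : ℕ), meanLevelEntropy m n a k ≤ d
  | 0, _, _ => by simp
  | n + 1, a, 0 => octantEntropy_le hm n a
  | n + 1, a, k + 1 => by
    rw [meanLevelEntropy_succ]
    calc ∑ e, octantMass m n a e / (∑ x ∈ dyadicCube (n + 1) a, m x) *
          meanLevelEntropy m n (childCorner n a e) k
        ≤ ∑ e, octantMass m n a e / (∑ x ∈ dyadicCube (n + 1) a, m x) * d :=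
          sum_le_sum fun e _ => mul_le_mul_of_nonneg_left (meanLevelEntropy_le hm n _ k)
            (octantMass_div_nonneg hm n a e)
      _ = (∑ e, octantMass m n a e / ∑ x ∈ dyadicCube (n + 1) a, m x) * d := by rw [sum_mul]
      _ ≤ 1 * d := mul_le_mul_of_nonneg_right (sum_octantMass_div_le_one n a) (Nat.cast_nonneg d)
      _ = d := one_mul _

/-- **One step of the chain rule on a cube**: the entropy of the normalised atomic measure on the sites
of `Q = dyadicCube (n+1) a` equals the octant-splitting entropy of `Q` plus the mass-weighted entropies
of the normalised measures on its children (`splittingEntropy_fiberwise` for the map `octantOf`).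
[cite: Leinster2021, Prop. 2.2.8] -/
theorem splittingEntropy_dyadicCube_succ (m : (Fin d → ℤ) → ℝ) (hm : ∀ x, 0 ≤ m x) (n : ℕ)
    (a : Fin d → ℤ) :
    splittingEntropy (dyadicCube (n + 1) a) m =
      octantEntropy m n a +
      ∑ e, octantMass m n a e / (∑ x ∈ dyadicCube (n + 1) a, m x) *
        splittingEntropy (dyadicCube n (childCorner n a e)) m := by
  have h := splittingEntropy_fiberwise (dyadicCube (n + 1) a) univ (octantOf n a)
    (fun x _ => mem_univ _) m (fun x _ => hm x)
  simp only [filter_octantOf_eq] at h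
  exact h

/-- **Chain rule along the mass-driven octree chain** (exact identity): for a nonnegative weight `m`
and the cube `Q₀ = dyadicCube n a` of level `n` (split `n` times, down to single sites), the level
entropies add up to the Shannon entropy (bits) of the normalised atomic measure `μ|_{Q₀}/μ(Q₀)`:
`∑_{k < n} h_k = H(Q₀, m)`. Furstenberg: `(1/L) ∑_{j<L} 𝒯ʲ𝓔(Θ) = -(1/L) ∑_{|w|=L} Θ(w) log Θ(w)`.
[cite: Furstenberg2014, Ch. 11, p. 42] -/
theorem sum_range_meanLevelEntropy (m : (Fin d → ℤ) → ℝ) (hm : ∀ x, 0 ≤ m x) :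
    ∀ (n : ℕ) (a : Fin d → ℤ),
      ∑ k ∈ range n, meanLevelEntropy m n a k = splittingEntropy (dyadicCube n a) m
  | 0, a => by simp [dyadicCube_zero]
  | n + 1, a => by
    rw [sum_range_succ', splittingEntropy_dyadicCube_succ m hm n a, meanLevelEntropy_zero, add_comm]
    congr 1
    simp only [meanLevelEntropy_succ]
    rw [sum_comm]
    refine sum_congr rfl fun e _ => ?_
    rw [← mul_sum, sum_range_meanLevelEntropy m hm n (childCorner n a e)]

/-- **Counting measure**: for a finite set of sites `S` inside the cube `Q₀ = dyadicCube n a`, the level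
entropies of the counting measure of `S` along the mass-driven chain add up to `log₂ #S` EXACTLY
(`S = ∅`: both sides `0`). With `n = K + 1` and `Q₀ = [-2^K, 2^K)^3` this is the route's
`log₂ mass_K = ∑_{k=0}^{K} h_k`, configuration by configuration. Furstenberg: for the uniform tree
`(1/l) ∑_{j<l} 𝒯ʲ𝓔(Θ_l) = log N_l(τ_l) / l`. [cite: Furstenberg2014, Ch. 12, p. 46] -/
theorem sum_range_meanLevelEntropy_indicator (S : Finset (Fin d → ℤ)) (n : ℕ) (a : Fin d → ℤ)
    (hS : S ⊆ dyadicCube n a) :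
    ∑ k ∈ range n, meanLevelEntropy (fun x => if x ∈ S then (1 : ℝ) else 0) n a k = Real.logb 2 #S := by
  rw [sum_range_meanLevelEntropy _ (fun x => by positivity) n a, splittingEntropy_indicator,
    inter_eq_right.2 hS]

end Octree

/-! ## The splitting entropy on the states of the CP-chain -/

section CP

open _root_.MeasureTheory

variable {d : ℕ}

/-- Splitting a sum over words of length `k+1` by the first letter:
`∑_{w ∈ Λ^{k+1}} f(w) = ∑_{a ∈ Λ} ∑_{w' ∈ Λ^k} f(a w')`. [folklore] -/
theorem sum_pi_fin_succ {M : Type*} [AddCommMonoid M] {Λ : Type*} [Fintype Λ] (k : ℕ)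
    (f : (Fin (k + 1) → Λ) → M) : ∑ w, f w = ∑ a, ∑ w : Fin k → Λ, f (Fin.cons a w) := by
  rw [← Fintype.sum_prod_type']
  exact (Fintype.sum_equiv (Fin.consEquiv fun _ => Λ) _ _ fun p => rfl).symm

/-- The child masses `θ(C_ε)` of a state are finite reals summing to `1`. [folklore] -/
theorem sum_toReal_measure_childCube (θ : CPState d) :
    ∑ ε : Octant d, ((θ : Measure (Fin d → ℝ)) (childCube d ε)).toReal = 1 := by
  rw [← ENNReal.toReal_sum (fun ε _ => measure_ne_top _ _), sum_measure_childCube, θ.measure_unitCube,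
    ENNReal.toReal_one]

/-- **Furstenberg's entropy function at a state of the CP-chain**:
`𝓔(θ) = -∑_ε θ(C_ε) log₂ θ(C_ε)`, the octant-splitting entropy (bits) of the probability measure `θ` on
`[0,1)^d` over its `2^d` children `C_ε` — `splittingEntropy` of the child masses (which already sum to
`1`, `cpEntropy_eq`). Its mean against an ergodic CP-distribution is the dimension (Furstenberg 2008,
Thm. 2.1; not stated here). [cite: Furstenberg2014, Ch. 11, p. 42] -/
def cpEntropy (θ : CPState d) : ℝ :=
  splittingEntropy univ fun ε : Octant d => ((θ : Measure (Fin d → ℝ)) (childCube d ε)).toReal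

/-- `𝓔(θ) = (∑_ε negMulLog (θ C_ε)) / log 2` (no normalisation needed: `∑_ε θ(C_ε) = 1`). [folklore] -/
theorem cpEntropy_eq (θ : CPState d) :
    cpEntropy θ =
      (∑ ε : Octant d, negMulLog ((θ : Measure (Fin d → ℝ)) (childCube d ε)).toReal) / Real.log 2 := by
  rw [cpEntropy, splittingEntropy, sum_toReal_measure_childCube]
  simp only [div_one]

/-- `0 ≤ 𝓔(θ)`. [folklore] -/
theorem cpEntropy_nonneg (θ : CPState d) : 0 ≤ cpEntropy θ :=
  splittingEntropy_nonneg _ _ fun _ _ => ENNReal.toReal_nonneg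

/-- `𝓔(θ) ≤ d` bits. [folklore] -/
theorem cpEntropy_le (θ : CPState d) : cpEntropy θ ≤ d := by
  have h := splittingEntropy_le_logb_card univ
    (fun ε : Octant d => ((θ : Measure (Fin d → ℝ)) (childCube d ε)).toReal)
    fun _ _ => ENNReal.toReal_nonneg
  rw [card_univ, card_octant, Nat.cast_pow, Nat.cast_ofNat, Real.logb_pow,
    Real.logb_self_eq_one one_lt_two, mul_one] at h
  exact h

/-- The cell masses `θ(D_w)` over the words of length `k` are finite reals summing to `1` (the law
`lawAt θ k` of the chain at time `k` is a probability). [folklore] -/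
theorem sum_toReal_cellMass : ∀ (k : ℕ) (θ : CPState d),
    ∑ w : Fin k → Octant d, (cellMass d θ (List.ofFn w)).toReal = 1
  | 0, θ => by simp [cellMass]
  | k + 1, θ => by
    rw [sum_pi_fin_succ k]
    simp only [List.ofFn_succ, Fin.cons_zero, Fin.cons_succ, cellMass, ENNReal.toReal_mul, ← mul_sum,
      sum_toReal_cellMass k, mul_one]
    exact sum_toReal_measure_childCube θ

/-- **Mean splitting entropy of the CP-chain at time `k`** started at `θ`:
`∑_{|w| = k} θ(D_w) 𝓔(θ^{D_w})`, i.e. `E_{lawAt θ k}[𝓔]` written out on the `2^{dk}` words exactly as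
`lawAt` is — Furstenberg's `(𝒯ᵏ𝓔)(Θ) = ∑_{|w|=k} Θ(w) 𝓔(Θ^w)`, in base `2`.
[cite: Furstenberg2014, Ch. 11, p. 42] -/
def cpLevelEntropy (θ : CPState d) (k : ℕ) : ℝ :=
  ∑ w : Fin k → Octant d, (cellMass d θ (List.ofFn w)).toReal * cpEntropy (zoomAlong d θ (List.ofFn w))

/-- At time `0` the mean entropy is `𝓔(θ)`. [folklore] -/
theorem cpLevelEntropy_zero (θ : CPState d) : cpLevelEntropy θ 0 = cpEntropy θ := by
  simp [cpLevelEntropy, cellMass, zoomAlong]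

/-- **First-step (Markov) recursion** `(𝒯ᵏ⁺¹𝓔)(θ) = ∑_ε θ(C_ε) (𝒯ᵏ𝓔)(θ^{C_ε})` — the same
recursion as `meanLevelEntropy_succ` for the discrete chain. [folklore] -/
theorem cpLevelEntropy_succ (θ : CPState d) (k : ℕ) :
    cpLevelEntropy θ (k + 1) =
      ∑ ε : Octant d, ((θ : Measure (Fin d → ℝ)) (childCube d ε)).toReal *
        cpLevelEntropy (zoomState d θ ε) k := by
  unfold cpLevelEntropy
  rw [sum_pi_fin_succ k]
  simp only [List.ofFn_succ, Fin.cons_zero, Fin.cons_succ, cellMass, zoomAlong, ENNReal.toReal_mul,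
    mul_assoc, ← mul_sum]

/-- `0 ≤ (𝒯ᵏ𝓔)(θ)`. [folklore] -/
theorem cpLevelEntropy_nonneg (θ : CPState d) (k : ℕ) : 0 ≤ cpLevelEntropy θ k :=
  sum_nonneg fun _ _ => mul_nonneg ENNReal.toReal_nonneg (cpEntropy_nonneg _)

/-- `(𝒯ᵏ𝓔)(θ) ≤ d` bits (a convex combination of values of `𝓔 ≤ d`). [folklore] -/
theorem cpLevelEntropy_le (θ : CPState d) (k : ℕ) : cpLevelEntropy θ k ≤ d := by
  calc cpLevelEntropy θ k
      ≤ ∑ w : Fin k → Octant d, (cellMass d θ (List.ofFn w)).toReal * d :=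
        sum_le_sum fun w _ => mul_le_mul_of_nonneg_left (cpEntropy_le _) ENNReal.toReal_nonneg
    _ = d := by rw [← sum_mul, sum_toReal_cellMass, one_mul]

end CP

end Literature.Dynamics.FractalDistributions
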